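import Literature.AlgebraicGeometry.HodgeTheory.SmoothHypersurfaceGeometricGenus
import Literature.AlgebraicGeometry.HodgeTheory.SmoothHypersurfaceGeometricGenusLowerBound
import Literature.AlgebraicGeometry.HodgeTheory.AlgebraicChartHodgeModel
import Literature.AlgebraicGeometry.HodgeTheory.BettiUniverseIsoTransport
import Literature.AlgebraicGeometry.HodgeTheory.HodgeFiltrationModelsReductionProofs
import HarnessLib

/-!
# The frame of `FⁿHⁿ = H^{n,0}` of a smooth hypersurface by Griffiths residues of pole order one, on the
# algebraic-chart model

Family `hodge`, layer `Literature/AlgebraicGeometry/HodgeTheory`. Theorems only (no definition, no named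
fact). Written by the prover seat `hodge-nonav-20241-p1` (g17, cell `hodge-nonav`) as brick FF2 of
prover-Ax's programme «B4 RELATIVE RESIDUES» (route `HodgeConjecture/CyclicUnitaryPowers`,
`--supports stmt-HodgeConjecture-19544`).

Let `X` be smooth projective of dimension `n ≥ 1` and `ι : X ⟶ ℙⁿ⁺¹` ANY morphism whose
homogeneous-coordinate map `ψ = hypersurfacePoint ι : X(ℂ) → ℙ(ℂⁿ⁺²)` is a topological embedding with
image `V(F)`, `F` a NONSINGULAR form of degree `d ≥ n + 2`, read on a Hodge model `A` through
`ψ_A = ψ ∘ φ_A` with HOLOMORPHIC affine coordinates (hypothesis `HasHolomorphicCoords`; for the fibres of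
a hypersurface family these four inputs are `HypersurfaceFamilyCoordinates`). The tree proves Voisin II
Cor. 6.12 at `p = 1` for the subscheme `hypersurface F` and any of its Hodge models
(`exists_residueMap_poleOrderOne`, `geometricGenus_eq_choose`); this file re-reads it for such an
`(X, ι)` on the rational side `ℂ ⊗_ℚ Hⁿ(X(ℂ); ℚ)` and packages it as a FRAME:

* `isHolomorphicInCharts_residueForm_of_hypersurfacePoint` — `ψ_A^* Res(PΩ/F)` is holomorphic in charts
  (`deg P = d − n − 2`): the closed-form witness a consumer names.
* `exists_residueClassMap` — for every Hodge model `A`: a `ℂ`-linear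
  `res : ℂ[x₀,…,x_{n+1}] → ℂ ⊗_ℚ Hⁿ(X(ℂ); ℚ)` with `Θ_A (res P) = [α]_A` (`A.topHolFormClass`) for every
  holomorphic-in-charts witness `α` of `ψ_A^* Res(PΩ/F)`, image in `Θ_A⁻¹(H^{n,0})`, injective on
  `S^{d−n−2}`.
* `finrank_holFormsInCharts_le_choose_of_hypersurfacePoint`, `hodgeStructure_F_self_eq_ratPiece`,
  `finrank_hodgeStructure_F_self_eq_choose` — `dim Fⁿ(A.hodgeStructure) = C(d−1, n+1)` (every holomorphic
  top form is a residue — `Residues.finrank_holFormsInCharts_le` in transversal normal form; and the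
  injection).
* **`residueFrame_of_hypersurfacePoint`** — on the ALGEBRAIC-CHART model `B = algebraicModel hX`
  (carrier `X(ℂ)`, `φ_B = id`, comparison `(∫ ⊗ ℂ)`): forms `P₁,…,P_r` of degree `d − n − 2`,
  `r = C(d−1, n+1)`, such that for ANY holomorphic-in-charts witnesses `αⱼ` of `Res(PⱼΩ/F)` the classes
  `xⱼ = Θ_B⁻¹((∫ ⊗ ℂ)[αⱼ]) ∈ ℂ ⊗_ℚ Hⁿ(X(ℂ); ℚ)` are LINEARLY INDEPENDENT and
  `Fⁿ(A.hodgeStructure hX hA n) = span x` for EVERY Hodge-symmetric model `A` — the `Fⁿ`-frame of one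
  fibre consumed by the relative period bricks.

Honest scope: one hypersurface at a time; nothing here says HC or any rung is proved.

## References

* [VoisinHodgeII2003] C. Voisin, Hodge Theory and Complex Algebraic Geometry II (2003), §6.1.3 Thm. 6.10,
  Cor. 6.12 (p = 1).
* [VoisinHodgeI2002] C. Voisin, Hodge Theory and Complex Algebraic Geometry I (2002), §7.1.1 Cor. 7.6.
* [Arapura2012] D. Arapura, Algebraic Geometry over the Complex Numbers (2012), §17.3 (17.3.1).
* [SerreGAGA1956] J.-P. Serre, GAGA, Ann. Inst. Fourier 6 (1956), §2 n°5.
-/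

noncomputable section

open scoped Manifold ContDiff _root_.Topology _root_.LinearAlgebra.Projectivization TensorProduct
open CategoryTheory AlgebraicGeometry Set Function Projectivization

namespace Literature.AlgebraicGeometry.HodgeTheory

open Literature.AlgebraicGeometry.Motives Literature.AlgebraicTopology.SingularHomology
  Literature.NumberTheory.Transcendental Literature.Geometry.Kaehler
  Literature.AlgebraicGeometry.HodgeTheory.HypersurfaceTopForms.Residues
  Literature.AlgebraicGeometry.HodgeTheory.HypersurfaceTopForms.GeometricGenus
  Literature.AlgebraicTopology.CharacteristicClasses

section HodgeTheory

variable {n : ℕ} {X : Motives.SchemeOver ℂ} {F : MvPolynomial (Fin (n + 2)) ℂ} {d : ℕ}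

/-! ### §1 The residue forms on a Hodge model, through `ι` -/

/-- The image of `ψ_A = ψ ∘ φ_A` is the image of `ψ` (`φ_A` is onto `X(ℂ)`). [cite: SerreGAGA1956, §2 n°5] -/
theorem range_hypersurfacePoint_comp_toComplexPoints (ι : X ⟶ projectiveSpace (n + 1) ℂ)
    (hrange : Set.range (hypersurfacePoint ι) = projZeroLocus {F}) (A : HodgeModel n X) :
    Set.range (hypersurfacePoint ι ∘ A.toComplexPoints) = projZeroLocus {F} := by
  rw [Set.range_comp, A.isAnalytification.isHomeomorph.surjective.range_eq, Set.image_univ, hrange]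

/-- `ψ_A = ψ ∘ φ_A` is a topological embedding when `ψ` is. [cite: SerreGAGA1956, §2 n°5] -/
theorem isEmbedding_hypersurfacePoint_comp_toComplexPoints (ι : X ⟶ projectiveSpace (n + 1) ℂ)
    (hemb : Topology.IsEmbedding (hypersurfacePoint ι)) (A : HodgeModel n X) :
    Topology.IsEmbedding (hypersurfacePoint ι ∘ A.toComplexPoints) :=
  hemb.comp A.isAnalytification.homeomorph.isEmbedding

/-- **`ψ_A^* Res(PΩ/F)` is holomorphic in charts** for `P` homogeneous of degree `d − n − 2`
(`isHolomorphicInCharts_residueForm` with the Jacobian clause of the nonsingular `F`) — the witness by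
which a consumer names the CLOSED form `holFormsInChartsToClosed _ ⟨_, this⟩`.
[cite: VoisinHodgeII2003, §6.1.3 Thm. 6.10] -/
theorem isHolomorphicInCharts_residueForm_of_hypersurfacePoint (hd : n + 2 ≤ d) (hF : F.IsHomogeneous d)
    (ι : X ⟶ projectiveSpace (n + 1) ℂ) (hemb : Topology.IsEmbedding (hypersurfacePoint ι))
    (hrange : Set.range (hypersurfacePoint ι) = projZeroLocus {F})
    (hJ : SmoothHypersurface.IsNonsingularForm ℂ F) (A : HodgeModel n X)
    (hhol : HasHolomorphicCoords A.model (hypersurfacePoint ι ∘ A.toComplexPoints))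
    {P : MvPolynomial (Fin (n + 2)) ℂ} (hP : P.IsHomogeneous (d - (n + 2))) :
    IsHolomorphicInCharts (residueForm (E := A.model) (hypersurfacePoint ι ∘ A.toComplexPoints) F P) :=
  isHolomorphicInCharts_residueForm _ hF (isEmbedding_hypersurfacePoint_comp_toComplexPoints ι hemb A).continuous
    (range_hypersurfacePoint_comp_toComplexPoints ι hrange A).le
    (fun _ hz hFz ↦ hJ.exists_eval_pderiv_ne_zero hz hFz) hhol hP hd

/-! ### §2 The residue class map on the rational side -/

/-- **Griffiths' residues at pole order one, on the rational side, for `X ≅ V(F)` presented by `ι`**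
(Voisin II Cor. 6.12 at `p = 1`): for `F` nonsingular of degree `d ≥ n + 2`, `n ≥ 1`, `X` smooth
projective of dimension `n`, `ψ = hypersurfacePoint ι` an embedding onto `V(F)`, and ANY Hodge model `A`
of `X` with `ψ ∘ φ_A` holomorphic in affine coordinates: a `ℂ`-linear
`res : ℂ[x₀,…,x_{n+1}] → ℂ ⊗_ℚ Hⁿ(X(ℂ); ℚ)` such that (class) `Θ_A (res P) = [α]_A` for EVERY
holomorphic-in-charts witness `α` of the residue form of `P` homogeneous of degree `d − n − 2`; (type)
`res P ∈ Θ_A⁻¹(H^{n,0})`; (inj) `res P = 0 → P = 0` on such `P`.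
[cite: VoisinHodgeII2003, §6.1.3 Thm. 6.10 and Cor. 6.12 (p = 1)] [cite: VoisinHodgeI2002, §7.1.1 Cor. 7.6] -/
theorem exists_residueClassMap (hn : 1 ≤ n) (hd : n + 2 ≤ d) (hF : F.IsHomogeneous d)
    (ι : X ⟶ projectiveSpace (n + 1) ℂ) (hemb : Topology.IsEmbedding (hypersurfacePoint ι))
    (hrange : Set.range (hypersurfacePoint ι) = projZeroLocus {F})
    (hJ : SmoothHypersurface.IsNonsingularForm ℂ F) (hX : IsSmoothProjective n X) (A : HodgeModel n X)
    (hhol : HasHolomorphicCoords A.model (hypersurfacePoint ι ∘ A.toComplexPoints)) :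
    ∃ res : MvPolynomial (Fin (n + 2)) ℂ →ₗ[ℂ] ℂ ⊗[ℚ] singularCohomology ℚ ℚ (ComplexPoints X) n,
      (∀ P : MvPolynomial (Fin (n + 2)) ℂ, P.IsHomogeneous (d - (n + 2)) →
        ∀ α : holFormsInCharts A.model A.carrier n,
          (α : MForm 𝓘(ℝ, A.model) A.carrier ℂ n) =
            residueForm (E := A.model) (hypersurfacePoint ι ∘ A.toComplexPoints) F P →
          A.complexification hX n (res P) = A.topHolFormClass α) ∧
      (∀ P, res P ∈ A.ratPiece hX n n 0) ∧
      (∀ P : MvPolynomial (Fin (n + 2)) ℂ, P.IsHomogeneous (d - (n + 2)) → res P = 0 → P = 0) := by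
  classical
  have hψemb := isEmbedding_hypersurfacePoint_comp_toComplexPoints ι hemb A
  have hψrange := range_hypersurfacePoint_comp_toComplexPoints ι hrange A
  have hjac : ∀ z : Fin (n + 2) → ℂ, z ≠ 0 → MvPolynomial.eval z F = 0 →
      ∃ j, MvPolynomial.eval z (MvPolynomial.pderiv j F) ≠ 0 :=
    fun z hz hFz ↦ hJ.exists_eval_pderiv_ne_zero hz hFz
  set ψ : A.carrier → ℙ ℂ (Fin (n + 2) → ℂ) := hypersurfacePoint ι ∘ A.toComplexPoints with hψ
  haveI : CompactSpace A.carrier := A.compactSpace_carrier hX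
  haveI : Nonempty A.carrier := A.nonempty_carrier hX
  set k := d - (n + 2) with hk
  have hhom : ∀ P : MvPolynomial (Fin (n + 2)) ℂ,
      (MvPolynomial.homogeneousComponent k P).IsHomogeneous (d - (n + 2)) := fun P ↦
    MvPolynomial.homogeneousComponent_isHomogeneous k P
  -- the residue FORM of the degree-`k` component, a holomorphic `n`-form, linear in `P`
  let L : MvPolynomial (Fin (n + 2)) ℂ →ₗ[ℂ] holFormsInCharts A.model A.carrier n :=
    { toFun := fun P ↦ ⟨residueForm (E := A.model) ψ F (MvPolynomial.homogeneousComponent k P),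
        isHolomorphicInCharts_residueForm ψ hF hψemb.continuous hψrange.le hjac hhol (hhom P) hd⟩
      map_add' := fun P Q ↦ by
        apply Subtype.ext
        change residueForm (E := A.model) ψ F (MvPolynomial.homogeneousComponent k (P + Q)) =
          residueForm ψ F (MvPolynomial.homogeneousComponent k P) +
            residueForm ψ F (MvPolynomial.homogeneousComponent k Q)
        rw [map_add, residueForm_add]
      map_smul' := fun c P ↦ by
        apply Subtype.ext
        change residueForm (E := A.model) ψ F (MvPolynomial.homogeneousComponent k (c • P)) =
          c • residueForm ψ F (MvPolynomial.homogeneousComponent k P)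
        rw [map_smul, residueForm_smul] }
  have hL : ∀ P, (L P : MForm 𝓘(ℝ, A.model) A.carrier ℂ n) =
      residueForm (E := A.model) ψ F (MvPolynomial.homogeneousComponent k P) := fun P ↦ rfl
  -- its class, carried to `ℂ ⊗ Hⁿ(X(ℂ); ℚ)`
  let res : MvPolynomial (Fin (n + 2)) ℂ →ₗ[ℂ] ℂ ⊗[ℚ] singularCohomology ℚ ℚ (ComplexPoints X) n :=
    (A.complexification hX n).symm.toLinearMap ∘ₗ A.topHolFormClass ∘ₗ L
  have hres : ∀ P, A.complexification hX n (res P) = A.topHolFormClass (L P) := fun P ↦ by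
    change A.complexification hX n ((A.complexification hX n).symm (A.topHolFormClass (L P))) = _
    exact LinearEquiv.apply_symm_apply _ _
  refine ⟨res, fun P hP α hα ↦ ?_, fun P ↦ ?_, fun P hP h0 ↦ ?_⟩
  · -- (class)
    rw [hres]
    congr 1
    apply Subtype.ext
    rw [hL, MvPolynomial.homogeneousComponent_eq_self hP]
    exact hα.symm
  · -- (type) `(n, 0)`
    rw [HodgeModel.mem_ratPiece_iff, hres]
    exact A.topHolFormClass_mem_hodgePQ _
  · -- (inj)
    have hPk : MvPolynomial.homogeneousComponent k P = P := MvPolynomial.homogeneousComponent_eq_self hP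
    have h1 : A.topHolFormClass (L P) = 0 := by rw [← hres, h0, map_zero]
    have h2 : L P = 0 := A.topHolFormClass_injective hX (by rw [h1, map_zero])
    have h3 : residueForm (E := A.model) ψ F P = 0 := by
      have h := congrArg (fun η : holFormsInCharts A.model A.carrier n ↦
        (η : MForm 𝓘(ℝ, A.model) A.carrier ℂ n)) h2
      simp only [hL, hPk, Submodule.coe_zero] at h
      exact h
    exact eq_zero_of_residueForm_eq_zero hF (hJ.prime hn (by omega) hF) hd hψemb hψrange hjac hhol
      A.finrank_model hP h3

/-! ### §3 Dimension: `dim Fⁿ Hⁿ = C(d − 1, n + 1)` -/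

/-- **`dim_ℂ Ωⁿ(X^an) ≤ C(d−1, n+1)`** for every Hodge model of `X ≅ V(F)` read through `ι` (every
holomorphic top form is a residue: transport to the transversal normal form and
`Residues.finrank_holFormsInCharts_le`, as in `finrank_holFormsInCharts_hodgeModel_le`).
[cite: VoisinHodgeII2003, §6.1.3 Cor. 6.12 (p = 1)] [cite: Arapura2012, §17.3 (17.3.1)] -/
theorem finrank_holFormsInCharts_le_choose_of_hypersurfacePoint (hn : 1 ≤ n) (hd : n + 2 ≤ d)
    (hF : F.IsHomogeneous d) (ι : X ⟶ projectiveSpace (n + 1) ℂ)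
    (hemb : Topology.IsEmbedding (hypersurfacePoint ι))
    (hrange : Set.range (hypersurfacePoint ι) = projZeroLocus {F})
    (hJ : SmoothHypersurface.IsNonsingularForm ℂ F) (hX : IsSmoothProjective n X) (A : HodgeModel n X)
    (hhol : HasHolomorphicCoords A.model (hypersurfacePoint ι ∘ A.toComplexPoints)) :
    Module.finrank ℂ ↥(holFormsInCharts A.model A.carrier n) ≤ Nat.choose (d - 1) (n + 1) := by
  classical
  haveI : CompactSpace A.carrier := A.compactSpace_carrier hX
  haveI : Nonempty A.carrier := A.nonempty_carrier hX
  haveI : NeZero n := ⟨by omega⟩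
  have hψemb := isEmbedding_hypersurfacePoint_comp_toComplexPoints ι hemb A
  have hψrange := range_hypersurfacePoint_comp_toComplexPoints ι hrange A
  have hjac : ∀ z : Fin (n + 2) → ℂ, z ≠ 0 → MvPolynomial.eval z F = 0 →
      ∃ j, MvPolynomial.eval z (MvPolynomial.pderiv j F) ≠ 0 :=
    fun z hz hFz ↦ hJ.exists_eval_pderiv_ne_zero hz hFz
  set ψ : A.carrier → ℙ ℂ (Fin (n + 2) → ℂ) := hypersurfacePoint ι ∘ A.toComplexPoints with hψ
  have hirr : Irreducible F := hJ.irreducible hn (by omega) hF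
  have hF0 : F ≠ 0 := hirr.ne_zero
  obtain ⟨L, g, hG0, hg0, hg, hsimple⟩ := TransversalLine.exists_linSubst_transversal_line hF hirr
  set G := TransversalLine.linSubst (L : (Fin (n + 2) → ℂ) →ₗ[ℂ] (Fin (n + 2) → ℂ)) F with hGdef
  have hGhom : G.IsHomogeneous d := TransversalLine.isHomogeneous_linSubst _ hF
  have hGirr : Irreducible G := (TransversalLine.irreducible_linSubst_iff L F).mpr hirr
  have hGprime : Prime G := hGirr.prime
  have hGjac : ∀ z : Fin (n + 2) → ℂ, z ≠ 0 → MvPolynomial.eval z G = 0 →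
      ∃ j, MvPolynomial.eval z (MvPolynomial.pderiv j G) ≠ 0 :=
    isNonsingular_linSubst L (F := F) hjac
  set B : (Fin (n + 2) → ℂ) ≃L[ℂ] (Fin (n + 2) → ℂ) := L.symm.toContinuousLinearEquiv with hB
  set ψ' : A.carrier → ℙ ℂ (Fin (n + 2) → ℂ) := homeomorphOfContinuousLinearEquiv B ∘ ψ with hψ'
  have hemb' : Topology.IsEmbedding ψ' := (homeomorphOfContinuousLinearEquiv B).isEmbedding.comp hψemb
  have hrange' : Set.range ψ' = projZeroLocus {G} := range_comp_homeomorph ψ hF hF0 L hψrange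
  have hhol' : HasHolomorphicCoords A.model ψ' :=
    hasHolomorphicCoords_comp_homeomorph ψ B hψemb.continuous hhol
  exact finrank_holFormsInCharts_le ψ' hGhom hGprime hemb' hrange' hGjac hhol' A.finrank_model hd hG0 hg0 hg
    hsimple

/-- **`Fⁿ(ℂ ⊗ Hⁿ) = Θ_A⁻¹(H^{n,0})`** for the weight-`n` Hodge structure of a Hodge-symmetric model on `Hⁿ`
of an `n`-fold: `Fⁿ = F^{n+1} ⊔ V^{n,0}` (`F_eq_F_succ_sup_piece`) with `F^{n+1} = ⊥`, and `V^{n,0}` is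
`Θ_A⁻¹(H^{n,0})` (`piece_eq_ratPiece`). [cite: VoisinHodgeI2002, §7.1.1 Def. 7.4] -/
theorem hodgeStructure_F_self_eq_ratPiece (hX : IsSmoothProjective n X) (A : HodgeModel n X)
    (hA : A.IsHodgeSymmetric) : (A.hodgeStructure hX hA n).F n = A.ratPiece hX n n 0 := by
  have h := (A.hodgeStructure hX hA n).F_eq_F_succ_sup_piece (n : ℤ)
  have hbot : (A.hodgeStructure hX hA n).F ((n : ℤ) + 1) = ⊥ := by
    rw [HodgeModel.hodgeStructure_F]
    exact A.ratF_eq_bot hX n (by omega)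
  rw [hbot, bot_sup_eq, sub_self] at h
  rw [h]
  have h2 := A.piece_eq_ratPiece hX hA (show n + 0 = n from rfl)
  rw [Nat.cast_zero] at h2
  exact h2

/-- **`dim_ℂ Fⁿ(A.hodgeStructure) = C(d−1, n+1)`** for `X ≅ V(F)` read through `ι`, `F` nonsingular of
degree `d ≥ n + 2`, `n ≥ 1`, and every Hodge-symmetric model `A` with holomorphic affine coordinates:
`≤` by `Θ_A⁻¹(H^{n,0}) ≅ Ωⁿ(X^an)` (`ratPieceTopEquivForms`, Voisin I Cor. 7.6) and
`finrank_holFormsInCharts_le_choose_of_hypersurfacePoint`; `≥` by the injective residue map on `S^{d−n−2}`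
(`exists_residueClassMap`, `finrank_homogeneousSubmodule_sub_eq_choose`).
[cite: VoisinHodgeII2003, §6.1.3 Cor. 6.12 (p = 1)] [cite: Arapura2012, §17.3 (17.3.1)] -/
theorem finrank_hodgeStructure_F_self_eq_choose (hn : 1 ≤ n) (hd : n + 2 ≤ d) (hF : F.IsHomogeneous d)
    (ι : X ⟶ projectiveSpace (n + 1) ℂ) (hemb : Topology.IsEmbedding (hypersurfacePoint ι))
    (hrange : Set.range (hypersurfacePoint ι) = projZeroLocus {F})
    (hJ : SmoothHypersurface.IsNonsingularForm ℂ F) (hX : IsSmoothProjective n X) (A : HodgeModel n X)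
    (hA : A.IsHodgeSymmetric) (hhol : HasHolomorphicCoords A.model (hypersurfacePoint ι ∘ A.toComplexPoints)) :
    Module.finrank ℂ ↥((A.hodgeStructure hX hA n).F n) = Nat.choose (d - 1) (n + 1) := by
  classical
  rw [hodgeStructure_F_self_eq_ratPiece hX A hA]
  apply le_antisymm
  · rw [(A.ratPieceTopEquivForms hX (A.topHolFormClassPQ_bijective hX)).finrank_eq]
    exact finrank_holFormsInCharts_le_choose_of_hypersurfacePoint hn hd hF ι hemb hrange hJ hX A hhol
  · -- the injection `S^{d-n-2} ↪ Θ_A⁻¹(H^{n,0})`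
    obtain ⟨res, -, hpiece, hinj⟩ := exists_residueClassMap hn hd hF ι hemb hrange hJ hX A hhol
    set Sk := MvPolynomial.homogeneousSubmodule (Fin (n + 2)) ℂ (d - (n + 2)) with hSk
    haveI : Module.Finite ℚ ↥(singularCohomology ℚ ℚ (ComplexPoints X) n) := BettiUniverse.finite hX n
    haveI : Module.Finite ℂ ↥Sk :=
      Module.Finite.iff_fg.mpr (MvPolynomial.homogeneousSubmodule_fg (Fin (n + 2)) ℂ _)
    rw [← finrank_homogeneousSubmodule_sub_eq_choose hd]
    have hmaple : Sk.map res ≤ A.ratPiece hX n n 0 := by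
      rintro _ ⟨P, -, rfl⟩
      exact hpiece P
    have hker : Sk ⊓ LinearMap.ker res = ⊥ := by
      refine eq_bot_iff.mpr ?_
      rintro P ⟨hP, hPker⟩
      rw [Submodule.mem_bot]
      exact hinj P ((MvPolynomial.mem_homogeneousSubmodule _ P).mp hP) (LinearMap.mem_ker.mp hPker)
    have hrank := finrank_map_add_finrank_inf_ker res Sk
    rw [hker, finrank_bot, add_zero] at hrank
    rw [← hrank]
    exact Submodule.finrank_mono hmaple

/-- **`Fⁿ` does not depend on the Hodge-symmetric model** (model independence of the Hodge filtration,
`HodgeModel.hodgeStructure_eq_hodge`). [cite: VoisinHodgeI2002, §7.1.1 Def. 7.4] -/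
theorem hodgeStructure_F_eq_of_isHodgeSymmetric (hX : IsSmoothProjective n X) (A A' : HodgeModel n X)
    (hA : A.IsHodgeSymmetric) (hA' : A'.IsHodgeSymmetric) (k : ℕ) (p : ℤ) :
    (A.hodgeStructure hX hA k).F p = (A'.hodgeStructure hX hA' k).F p := by
  rw [HodgeModel.hodgeStructure_eq_hodge exists_isReal_hodgeModel_holds hodgePQ_independent_of_hodgeModel_holds
      hX A hA k,
    HodgeModel.hodgeStructure_eq_hodge exists_isReal_hodgeModel_holds hodgePQ_independent_of_hodgeModel_holds
      hX A' hA' k]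

/-! ### §4 The frame on the algebraic-chart model -/

/-- **The `Fⁿ`-frame of a smooth hypersurface by residues, on the algebraic-chart model** (FF2 of the
programme «B4 RELATIVE RESIDUES»). For `X` smooth projective of dimension `n ≥ 1`, `ι : X ⟶ ℙⁿ⁺¹` with
`ψ = hypersurfacePoint ι` an embedding onto `V(F)`, `F` nonsingular of degree `d ≥ n + 2`, and
`B = algebraicModel hX` (carrier `X(ℂ)`, `φ_B = id`, algebraic charts) with `ψ ∘ φ_B` holomorphic in
affine coordinates: there are forms `P₁, …, P_r` of degree `d − n − 2`, `r = C(d−1, n+1)`, such that for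
ANY holomorphic-in-charts witnesses `αⱼ` of `Res(PⱼΩ/F)` the classes
`xⱼ = Θ_B⁻¹((∫ ⊗ ℂ)[αⱼ]) ∈ ℂ ⊗_ℚ Hⁿ(X(ℂ); ℚ)`
(`(B.complexification hX n).symm (complexifyFun (integrationDeRhamIsoFamily B.model) n [αⱼ])`) are
LINEARLY INDEPENDENT and `Fⁿ(A.hodgeStructure hX hA n) = span x` for EVERY Hodge-symmetric model `A`.
Witnesses exist: `isHolomorphicInCharts_residueForm_of_hypersurfacePoint`.
[cite: VoisinHodgeII2003, §6.1.3 Cor. 6.12 (p = 1)] [cite: VoisinHodgeI2002, §7.1.1 Cor. 7.6]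
[cite: Arapura2012, §17.3 (17.3.1)] -/
theorem residueFrame_of_hypersurfacePoint (hn : 1 ≤ n) (hd : n + 2 ≤ d) (hF : F.IsHomogeneous d)
    (ι : X ⟶ projectiveSpace (n + 1) ℂ) (hemb : Topology.IsEmbedding (hypersurfacePoint ι))
    (hrange : Set.range (hypersurfacePoint ι) = projZeroLocus {F})
    (hJ : SmoothHypersurface.IsNonsingularForm ℂ F) (hX : IsSmoothProjective n X)
    (hhol : HasHolomorphicCoords (algebraicModel hX).model
      (hypersurfacePoint ι ∘ (algebraicModel hX).toComplexPoints)) :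
    ∃ (r : ℕ) (P : Fin r → MvPolynomial (Fin (n + 2)) ℂ),
      r = Nat.choose (d - 1) (n + 1) ∧ (∀ j, (P j).IsHomogeneous (d - (n + 2))) ∧
      ∀ (α : Fin r → holFormsInCharts (algebraicModel hX).model (algebraicModel hX).carrier n),
        (∀ j, (α j : MForm 𝓘(ℝ, (algebraicModel hX).model) (algebraicModel hX).carrier ℂ n) =
          residueForm (E := (algebraicModel hX).model)
            (hypersurfacePoint ι ∘ (algebraicModel hX).toComplexPoints) F (P j)) →
        LinearIndependent ℂ (fun j ↦ ((algebraicModel hX).complexification hX n).symm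
            (complexifyFun (integrationDeRhamIsoFamily (algebraicModel hX).model) n
              (complexDeRhamCohomology.mk _ _ n
                (holFormsInChartsToClosed (algebraicModel hX).finrank_model (α j))))) ∧
          ∀ (A : HodgeModel n X) (hA : A.IsHodgeSymmetric),
            (A.hodgeStructure hX hA n).F n =
              Submodule.span ℂ (Set.range fun j ↦ ((algebraicModel hX).complexification hX n).symm
                (complexifyFun (integrationDeRhamIsoFamily (algebraicModel hX).model) n
                  (complexDeRhamCohomology.mk _ _ n
                    (holFormsInChartsToClosed (algebraicModel hX).finrank_model (α j))))) := by
  classical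
  set B := algebraicModel hX with hBdef
  obtain ⟨res, hclass, hpiece, hinj⟩ := exists_residueClassMap hn hd hF ι hemb hrange hJ hX B hhol
  set k := d - (n + 2) with hk
  set Sk := MvPolynomial.homogeneousSubmodule (Fin (n + 2)) ℂ k with hSk
  haveI : Module.Finite ℚ ↥(singularCohomology ℚ ℚ (ComplexPoints X) n) := BettiUniverse.finite hX n
  haveI : Module.Finite ℂ ↥Sk :=
    Module.Finite.iff_fg.mpr (MvPolynomial.homogeneousSubmodule_fg (Fin (n + 2)) ℂ _)
  -- a basis of `S^k`
  set r := Module.finrank ℂ ↥Sk with hr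
  let b : Module.Basis (Fin r) ℂ ↥Sk := Module.finBasis ℂ ↥Sk
  have hbP : ∀ j, ((b j : ↥Sk) : MvPolynomial (Fin (n + 2)) ℂ).IsHomogeneous (d - (n + 2)) := fun j ↦
    (MvPolynomial.mem_homogeneousSubmodule _ _).mp (b j).2
  refine ⟨r, fun j ↦ (b j : MvPolynomial (Fin (n + 2)) ℂ), finrank_homogeneousSubmodule_sub_eq_choose hd,
    hbP, fun α hα ↦ ?_⟩
  -- the explicit classes ARE `res (b j)`
  have hx : ∀ j, (B.complexification hX n).symm
      (complexifyFun (integrationDeRhamIsoFamily B.model) n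
        (complexDeRhamCohomology.mk _ _ n (holFormsInChartsToClosed B.finrank_model (α j)))) =
      res (b j : MvPolynomial (Fin (n + 2)) ℂ) := by
    intro j
    rw [LinearEquiv.symm_apply_eq, hclass _ (hbP j) (α j) (hα j), HodgeModel.topHolFormClass_apply]
    rfl
  simp_rw [hx]
  -- `res` is injective on `S^k`
  have hker : LinearMap.ker (res.domRestrict Sk) = ⊥ := by
    refine eq_bot_iff.mpr fun P hP ↦ ?_
    rw [LinearMap.mem_ker, LinearMap.domRestrict_apply] at hP
    rw [Submodule.mem_bot]
    exact Subtype.ext (hinj _ ((MvPolynomial.mem_homogeneousSubmodule _ _).mp P.2) hP)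
  have hli : LinearIndependent ℂ (fun j ↦ res (b j : MvPolynomial (Fin (n + 2)) ℂ)) :=
    b.linearIndependent.map' _ hker
  refine ⟨hli, fun A hA ↦ ?_⟩
  rw [hodgeStructure_F_eq_of_isHodgeSymmetric hX A B hA (algebraicModel_isHodgeSymmetric hX)]
  have hle : Submodule.span ℂ (Set.range fun j ↦ res (b j : MvPolynomial (Fin (n + 2)) ℂ)) ≤
      (B.hodgeStructure hX (algebraicModel_isHodgeSymmetric hX) n).F n := by
    rw [hodgeStructure_F_self_eq_ratPiece hX B (algebraicModel_isHodgeSymmetric hX), Submodule.span_le]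
    rintro _ ⟨j, rfl⟩
    exact hpiece _
  refine (Submodule.eq_of_le_of_finrank_eq hle ?_).symm
  rw [finrank_span_eq_card hli, Fintype.card_fin,
    finrank_hodgeStructure_F_self_eq_choose hn hd hF ι hemb hrange hJ hX B (algebraicModel_isHodgeSymmetric hX)
      hhol, hr, finrank_homogeneousSubmodule_sub_eq_choose hd]

end HodgeTheory

end Literature.AlgebraicGeometry.HodgeTheory

end
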